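import Mathlib
import HarnessLib
import Summits.Ventures.LatticeQCDFlow.Scoring.AllPairsAcceptanceVariance
import Summits.Ventures.LatticeQCDFlow.Scaling.AcceptanceVolumeSandwich

/-!
# LatticeQCDFlow / Scaling — the acceptance volume sandwich on a GENERAL space:
# `acc(p, q)·acc(p′, q′) ≤ acc(p⊗p′, q⊗q′) ≤ acc(p, q)`

HONEST FRAMING: exact (Metropolis-corrected) sampling algorithms for lattice gauge theory;
figures of merit are autocorrelation/cost numbers at stated couplings and volumes; no
continuum-physics claim.

Venture `LatticeQCDFlow` (cell pub-lqcd), topic `Scaling`; FANOUT row 3 (`s0-u1-a`, S0-B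
implementation A, GEN-11).  NEW WORK of the cell (Fubini over the pair law), the measure-theoretic
twin of the lower half of row 3's finite `Scaling/AcceptanceVolumeSandwich` (imported for the
pointwise `min_mul_min_le_min_mul`), in the density setting of `Scoring/AllPairsAcceptanceVariance`
(imported): reference measures `μ` on `X` and `μ′` on `Y` (s-finite), targets `p ≥ 0` on `X`,
`p′ ≥ 0` on `Y` (`∫ = 1`), models `q, q′ > 0` with laws `q dμ`, `q′ dμ′` probability measures, the
product pair `P = p ⊗ p′`, `Q = q ⊗ q′` on `X × Y` with reference `μ ⊗ μ′`, and the equilibrium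
acceptances `acc(p, q) = ∫∫ min(p(a)q(b), p(b)q(a))`, `acc(P, Q)` likewise on the product space.
NO definition is introduced.

* `prodTarget_normalised`, `prodModel_withDensity_eq` — bookkeeping for `P`, `Q` (nonnegativity,
  measurability, integrability, `∫ P = 1`; `(Q d(μ⊗μ′)) = (q dμ) ⊗ (q′ dμ′)`, Mathlib's
  `prod_withDensity`);
* **`mul_meanAccept_le_meanAccept_prod`** — `acc(p, q)·acc(p′, q′) ≤ acc(p⊗p′, q⊗q′)`: write both
  sides under the model pair laws (`acc = ∫ min(w, w′) d(ν⊗ν)`,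
  `AllPairsVariance.integral_pairMin_withDensity_eq_meanAccept`), bound the product kernel below by
  `min(w(a), w(b))·min(w′(c), w′(d)) ≤ min(w(a)w′(c), w(b)w′(d))` and integrate (Fubini twice).

* (appended, GEN-11) `measurePreserving_rePair` — the re-pairing `((a,c),(b,d)) ↦ ((a,b),(c,d))`
  sends `(ν⊗ν′)⊗(ν⊗ν′)` to `(ν⊗ν)⊗(ν′⊗ν′)` (from Mathlib's `measurePreserving_prodAssoc`,
  `measurePreserving_swap`, `MeasurePreserving.prod`); **`meanAccept_prod_le_meanAccept_left`** —
  the CEILING `acc(p⊗p′, q⊗q′) ≤ acc(p, q)` (after re-pairing,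
  `∫∫ min(w(a)w′(c), w(b)w′(d)) dν′ dν′ ≤ min(w(a), w(b))` since `∫ w′ dν′ = 1`).

The `m`-block and hit-or-miss statements are in the finite file.  NOT CLAIMED: any acceptance of
ours; nothing re-scored.
-/

namespace Summit.Ventures.LatticeQCDFlow.Theory2

open MeasureTheory ProbabilityTheory Set
open Summit.Ventures.LatticeQCDFlow.Scoring
open Summit.Ventures.LatticeQCDFlow.Scoring.AllPairsVariance

variable {X Y : Type*} [MeasurableSpace X] [MeasurableSpace Y] {μ : Measure X} {μ' : Measure Y}
  [SFinite μ] [SFinite μ']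

/-- **The product target is a normalised density**: `P(x, y) = p(x)p′(y) ≥ 0` is measurable,
integrable w.r.t. `μ ⊗ μ′`, with `∫ P = 1`. [folklore] -/
theorem prodTarget_normalised {p : X → ℝ} {p' : Y → ℝ} (hp0 : ∀ x, 0 ≤ p x) (hpm : Measurable p)
    (hpi : Integrable p μ) (hp1 : ∫ x, p x ∂μ = 1) (hp0' : ∀ y, 0 ≤ p' y) (hpm' : Measurable p')
    (hpi' : Integrable p' μ') (hp1' : ∫ y, p' y ∂μ' = 1) :
    (∀ z : X × Y, 0 ≤ p z.1 * p' z.2) ∧ Measurable (fun z : X × Y => p z.1 * p' z.2) ∧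
    Integrable (fun z : X × Y => p z.1 * p' z.2) (μ.prod μ') ∧
    ∫ z, p z.1 * p' z.2 ∂(μ.prod μ') = 1 :=
  ⟨fun z => mul_nonneg (hp0 _) (hp0' _), (hpm.comp measurable_fst).mul (hpm'.comp measurable_snd),
    hpi.mul_prod hpi', by rw [integral_prod_mul, hp1, hp1', mul_one]⟩

omit [SFinite μ] in
/-- **The product model law is the product of the model laws**:
`(q⊗q′) d(μ⊗μ′) = (q dμ) ⊗ (q′ dμ′)`. [folklore] -/
theorem prodModel_withDensity_eq {q : X → ℝ} {q' : Y → ℝ} (hq0 : ∀ x, 0 < q x) (hqm : Measurable q)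
    (hqm' : Measurable q') :
    (μ.prod μ').withDensity (fun z : X × Y => ENNReal.ofReal (q z.1 * q' z.2))
      = (μ.withDensity fun x => ENNReal.ofReal (q x)).prod
          (μ'.withDensity fun y => ENNReal.ofReal (q' y)) := by
  rw [prod_withDensity hqm.ennreal_ofReal hqm'.ennreal_ofReal]
  congr 1
  funext z
  rw [ENNReal.ofReal_mul (hq0 _).le]

/-- **ACCEPTANCE IS SUPER-MULTIPLICATIVE OVER INDEPENDENT BLOCKS (general space).**  For normalised
targets `p, p′ ≥ 0` and positive models `q, q′` whose laws are probability measures: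
`acc(p, q)·acc(p′, q′) ≤ acc(p⊗p′, q⊗q′)`. [ours] -/
theorem mul_meanAccept_le_meanAccept_prod {p q : X → ℝ} {p' q' : Y → ℝ} (hp0 : ∀ x, 0 ≤ p x)
    (hpm : Measurable p) (hpi : Integrable p μ) (hp1 : ∫ x, p x ∂μ = 1) (hq0 : ∀ x, 0 < q x)
    (hqm : Measurable q) (hqi : Integrable q μ) (hp0' : ∀ y, 0 ≤ p' y) (hpm' : Measurable p')
    (hpi' : Integrable p' μ') (hp1' : ∫ y, p' y ∂μ' = 1) (hq0' : ∀ y, 0 < q' y)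
    (hqm' : Measurable q') (hqi' : Integrable q' μ')
    [IsProbabilityMeasure (μ.withDensity fun x => ENNReal.ofReal (q x))]
    [IsProbabilityMeasure (μ'.withDensity fun y => ENNReal.ofReal (q' y))] :
    (∫ a, ∫ b, min (p a * q b) (p b * q a) ∂μ ∂μ) * (∫ c, ∫ d, min (p' c * q' d) (p' d * q' c) ∂μ' ∂μ')
      ≤ ∫ z, ∫ z', min (p z.1 * p' z.2 * (q z'.1 * q' z'.2)) (p z'.1 * p' z'.2 * (q z.1 * q' z.2))
          ∂(μ.prod μ') ∂(μ.prod μ') := by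
  set ν := μ.withDensity fun x => ENNReal.ofReal (q x) with hν
  set ν' := μ'.withDensity fun y => ENNReal.ofReal (q' y) with hν'
  obtain ⟨hP0, hPm, hPi, hP1⟩ := prodTarget_normalised hp0 hpm hpi hp1 hp0' hpm' hpi' hp1'
  have hQ0 : ∀ z : X × Y, 0 < q z.1 * q' z.2 := fun z => mul_pos (hq0 _) (hq0' _)
  have hQm : Measurable (fun z : X × Y => q z.1 * q' z.2) :=
    (hqm.comp measurable_fst).mul (hqm'.comp measurable_snd)
  have hQi : Integrable (fun z : X × Y => q z.1 * q' z.2) (μ.prod μ') := hqi.mul_prod hqi'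
  have hN : (μ.prod μ').withDensity (fun z : X × Y => ENNReal.ofReal (q z.1 * q' z.2)) = ν.prod ν' :=
    prodModel_withDensity_eq hq0 hqm hqm'
  -- both sides under the model pair laws
  rw [← integral_pairMin_withDensity_eq_meanAccept hp0 hpm hpi hq0 hqm hqi,
    ← integral_pairMin_withDensity_eq_meanAccept hp0' hpm' hpi' hq0' hqm' hqi',
    ← integral_pairMin_withDensity_eq_meanAccept (μ := μ.prod μ') hP0 hPm hPi hQ0 hQm hQi, hN]
  -- the product kernel factorises: `W z = w z.1 * w' z.2`
  have hW : ∀ z : X × Y, p z.1 * p' z.2 / (q z.1 * q' z.2) = p z.1 / q z.1 * (p' z.2 / q' z.2) :=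
    fun z => mul_div_mul_comm _ _ _ _
  simp_rw [hW]
  -- integrability of the two kernels and of the product kernel
  have hF2 := memLp_pairMin_two (μ := μ) hp0 hpm hpi hq0 hqm
  have hG2 := memLp_pairMin_two (μ := μ') hp0' hpm' hpi' hq0' hqm'
  have hFi : Integrable (fun e : X × X => min (p e.1 / q e.1) (p e.2 / q e.2)) (ν.prod ν) :=
    hF2.integrable one_le_two
  have hGi : Integrable (fun e : Y × Y => min (p' e.1 / q' e.1) (p' e.2 / q' e.2)) (ν'.prod ν') :=
    hG2.integrable one_le_two
  have hK2 := memLp_pairMin_two (μ := μ.prod μ') hP0 hPm hPi hQ0 hQm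
  rw [hN] at hK2
  have hKi : Integrable (fun e : (X × Y) × (X × Y) =>
      min (p e.1.1 * p' e.1.2 / (q e.1.1 * q' e.1.2)) (p e.2.1 * p' e.2.2 / (q e.2.1 * q' e.2.2)))
      ((ν.prod ν').prod (ν.prod ν')) := hK2.integrable one_le_two
  simp_rw [hW] at hKi
  -- the lower product `min(w a, w b)·min(w' c, w' d)` is integrable: dominated by `w a · w' c`
  have hw : ∀ x, 0 ≤ p x / q x := fun x => div_nonneg (hp0 x) (hq0 x).le
  have hw' : ∀ y, 0 ≤ p' y / q' y := fun y => div_nonneg (hp0' y) (hq0' y).le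
  obtain ⟨hwi, -⟩ := integral_weight_withDensity_eq (μ := μ) hpi hq0 hqm
  obtain ⟨hwi', -⟩ := integral_weight_withDensity_eq (μ := μ') hpi' hq0' hqm'
  have hdom : Integrable (fun e : (X × Y) × (X × Y) => p e.1.1 / q e.1.1 * (p' e.1.2 / q' e.1.2))
      ((ν.prod ν').prod (ν.prod ν')) :=
    (hwi.mul_prod hwi').comp_fst _
  have hLm : AEStronglyMeasurable (fun e : (X × Y) × (X × Y) =>
      min (p e.1.1 / q e.1.1) (p e.2.1 / q e.2.1) * min (p' e.1.2 / q' e.1.2) (p' e.2.2 / q' e.2.2))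
      ((ν.prod ν').prod (ν.prod ν')) := by
    refine Measurable.aestronglyMeasurable (Measurable.mul ?_ ?_)
    · exact ((hpm.div hqm).comp (measurable_fst.comp measurable_fst)).min
        ((hpm.div hqm).comp (measurable_fst.comp measurable_snd))
    · exact ((hpm'.div hqm').comp (measurable_snd.comp measurable_fst)).min
        ((hpm'.div hqm').comp (measurable_snd.comp measurable_snd))
  have hLi : Integrable (fun e : (X × Y) × (X × Y) =>
      min (p e.1.1 / q e.1.1) (p e.2.1 / q e.2.1) * min (p' e.1.2 / q' e.1.2) (p' e.2.2 / q' e.2.2))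
      ((ν.prod ν').prod (ν.prod ν')) := by
    refine Integrable.mono' hdom hLm (Filter.Eventually.of_forall fun e => ?_)
    rw [Real.norm_of_nonneg (mul_nonneg (le_min (hw _) (hw _)) (le_min (hw' _) (hw' _)))]
    exact mul_le_mul (min_le_left _ _) (min_le_left _ _) (le_min (hw' _) (hw' _)) (hw _)
  -- the lower product integrates to `acc · acc'`
  have hval : ∫ e, min (p e.1.1 / q e.1.1) (p e.2.1 / q e.2.1)
      * min (p' e.1.2 / q' e.1.2) (p' e.2.2 / q' e.2.2) ∂((ν.prod ν').prod (ν.prod ν'))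
      = (∫ e, min (p e.1 / q e.1) (p e.2 / q e.2) ∂(ν.prod ν))
        * ∫ e, min (p' e.1 / q' e.1) (p' e.2 / q' e.2) ∂(ν'.prod ν') := by
    rw [integral_prod _ hLi]
    have inner : ∀ z : X × Y, ∫ z', min (p z.1 / q z.1) (p z'.1 / q z'.1)
        * min (p' z.2 / q' z.2) (p' z'.2 / q' z'.2) ∂(ν.prod ν')
        = (∫ b, min (p z.1 / q z.1) (p b / q b) ∂ν) * ∫ d, min (p' z.2 / q' z.2) (p' d / q' d) ∂ν' :=
      fun z => integral_prod_mul (μ := ν) (ν := ν') (fun b => min (p z.1 / q z.1) (p b / q b))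
        (fun d => min (p' z.2 / q' z.2) (p' d / q' d))
    simp_rw [inner]
    rw [integral_prod_mul (μ := ν) (ν := ν') (fun a => ∫ b, min (p a / q a) (p b / q b) ∂ν)
      (fun c => ∫ d, min (p' c / q' c) (p' d / q' d) ∂ν'),
      ← integral_prod _ hFi, ← integral_prod _ hGi]
  rw [← hval]
  exact integral_mono hLi hKi fun e => min_mul_min_le_min_mul (hw _) (hw _) (hw' _) (hw' _)


/-! ### The ceiling `acc(p⊗p′, q⊗q′) ≤ acc(p, q)` via the re-pairing of `(X × Y)²` -/

omit [SFinite μ] [SFinite μ'] in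
/-- **Re-pairing is measure preserving**: `((a, c), (b, d)) ↦ ((a, b), (c, d))` sends
`(ν ⊗ ν′) ⊗ (ν ⊗ ν′)` to `(ν ⊗ ν) ⊗ (ν′ ⊗ ν′)` (s-finite measures; built from Mathlib's
`measurePreserving_prodAssoc`, `measurePreserving_swap`, `MeasurePreserving.prod`). [folklore] -/
theorem measurePreserving_rePair (ν : Measure X) (ν' : Measure Y) [SFinite ν] [SFinite ν'] :
    MeasurePreserving (fun e : (X × Y) × (X × Y) => ((e.1.1, e.2.1), (e.1.2, e.2.2)))
      ((ν.prod ν').prod (ν.prod ν')) ((ν.prod ν).prod (ν'.prod ν')) := by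
  have h1 := measurePreserving_prodAssoc ν ν' (ν.prod ν')
  have h2 := (measurePreserving_prodAssoc ν' ν ν').symm _
  have h3 : MeasurePreserving (Prod.map Prod.swap id) ((ν'.prod ν).prod ν') ((ν.prod ν').prod ν') :=
    (Measure.measurePreserving_swap (μ := ν') (ν := ν)).prod (MeasurePreserving.id ν')
  have h4 := measurePreserving_prodAssoc ν ν' ν'
  have hin : MeasurePreserving (fun t : Y × (X × Y) => (t.2.1, (t.1, t.2.2)))
      (ν'.prod (ν.prod ν')) (ν.prod (ν'.prod ν')) := by
    have h := h4.comp (h3.comp h2)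
    refine ⟨?_, ?_⟩
    · exact (measurable_fst.comp measurable_snd).prodMk
        (measurable_fst.prodMk (measurable_snd.comp measurable_snd))
    · have e : (fun t : Y × (X × Y) => (t.2.1, (t.1, t.2.2)))
          = (⇑(MeasurableEquiv.prodAssoc : (X × Y) × Y ≃ᵐ X × Y × Y) ∘ (Prod.map Prod.swap id ∘
            ⇑(MeasurableEquiv.prodAssoc : (Y × X) × Y ≃ᵐ Y × X × Y).symm)) := by
        funext t
        rfl
      rw [e]
      exact h.map_eq
  have h5 : MeasurePreserving (Prod.map id (fun t : Y × (X × Y) => (t.2.1, (t.1, t.2.2))))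
      (ν.prod (ν'.prod (ν.prod ν'))) (ν.prod (ν.prod (ν'.prod ν'))) :=
    (MeasurePreserving.id ν).prod hin
  have h6 := (measurePreserving_prodAssoc ν ν (ν'.prod ν')).symm _
  have h := h6.comp (h5.comp h1)
  refine ⟨?_, ?_⟩
  · exact ((measurable_fst.comp measurable_fst).prodMk (measurable_fst.comp measurable_snd)).prodMk
      ((measurable_snd.comp measurable_fst).prodMk (measurable_snd.comp measurable_snd))
  · have e : (fun e : (X × Y) × (X × Y) => ((e.1.1, e.2.1), (e.1.2, e.2.2)))
        = (⇑(MeasurableEquiv.prodAssoc : (X × X) × (Y × Y) ≃ᵐ X × X × (Y × Y)).symm ∘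
          (Prod.map id (fun t : Y × (X × Y) => (t.2.1, (t.1, t.2.2))) ∘
            ⇑(MeasurableEquiv.prodAssoc : (X × Y) × (X × Y) ≃ᵐ X × Y × (X × Y)))) := by
      funext t
      rfl
    rw [e]
    exact h.map_eq

/-- **A BLOCK CAN ONLY COST ACCEPTANCE (general space)**: `acc(p⊗p′, q⊗q′) ≤ acc(p, q)` — after
re-pairing, `∫∫ min(w(a)w′(c), w(b)w′(d)) dν′(c) dν′(d) ≤ min(w(a), w(b))` because `∫ w′ dν′ = 1`.
[ours] -/
theorem meanAccept_prod_le_meanAccept_left {p q : X → ℝ} {p' q' : Y → ℝ} (hp0 : ∀ x, 0 ≤ p x)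
    (hpm : Measurable p) (hpi : Integrable p μ) (hq0 : ∀ x, 0 < q x)
    (hqm : Measurable q) (hqi : Integrable q μ) (hp0' : ∀ y, 0 ≤ p' y) (hpm' : Measurable p')
    (hpi' : Integrable p' μ') (hp1' : ∫ y, p' y ∂μ' = 1) (hq0' : ∀ y, 0 < q' y)
    (hqm' : Measurable q') (hqi' : Integrable q' μ')
    [IsProbabilityMeasure (μ.withDensity fun x => ENNReal.ofReal (q x))]
    [IsProbabilityMeasure (μ'.withDensity fun y => ENNReal.ofReal (q' y))] :
    ∫ z, ∫ z', min (p z.1 * p' z.2 * (q z'.1 * q' z'.2)) (p z'.1 * p' z'.2 * (q z.1 * q' z.2))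
          ∂(μ.prod μ') ∂(μ.prod μ')
      ≤ ∫ a, ∫ b, min (p a * q b) (p b * q a) ∂μ ∂μ := by
  set ν := μ.withDensity fun x => ENNReal.ofReal (q x) with hν
  set ν' := μ'.withDensity fun y => ENNReal.ofReal (q' y) with hν'
  have hP0 : ∀ z : X × Y, 0 ≤ p z.1 * p' z.2 := fun z => mul_nonneg (hp0 _) (hp0' _)
  have hPm : Measurable (fun z : X × Y => p z.1 * p' z.2) :=
    (hpm.comp measurable_fst).mul (hpm'.comp measurable_snd)
  have hPi : Integrable (fun z : X × Y => p z.1 * p' z.2) (μ.prod μ') := hpi.mul_prod hpi'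
  have hQ0 : ∀ z : X × Y, 0 < q z.1 * q' z.2 := fun z => mul_pos (hq0 _) (hq0' _)
  have hQm : Measurable (fun z : X × Y => q z.1 * q' z.2) :=
    (hqm.comp measurable_fst).mul (hqm'.comp measurable_snd)
  have hQi : Integrable (fun z : X × Y => q z.1 * q' z.2) (μ.prod μ') := hqi.mul_prod hqi'
  have hN : (μ.prod μ').withDensity (fun z : X × Y => ENNReal.ofReal (q z.1 * q' z.2)) = ν.prod ν' :=
    prodModel_withDensity_eq hq0 hqm hqm'
  rw [← integral_pairMin_withDensity_eq_meanAccept hp0 hpm hpi hq0 hqm hqi,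
    ← integral_pairMin_withDensity_eq_meanAccept (μ := μ.prod μ') hP0 hPm hPi hQ0 hQm hQi, hN]
  have hW : ∀ z : X × Y, p z.1 * p' z.2 / (q z.1 * q' z.2) = p z.1 / q z.1 * (p' z.2 / q' z.2) :=
    fun z => mul_div_mul_comm _ _ _ _
  simp_rw [hW]
  have hw : ∀ x, 0 ≤ p x / q x := fun x => div_nonneg (hp0 x) (hq0 x).le
  have hw' : ∀ y, 0 ≤ p' y / q' y := fun y => div_nonneg (hp0' y) (hq0' y).le
  obtain ⟨hwi', hw1'⟩ := integral_weight_withDensity_eq (μ := μ') hpi' hq0' hqm'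
  have hFi : Integrable (fun e : X × X => min (p e.1 / q e.1) (p e.2 / q e.2)) (ν.prod ν) :=
    (memLp_pairMin_two (μ := μ) hp0 hpm hpi hq0 hqm).integrable one_le_two
  -- transport the product kernel to the re-paired space
  have hT := measurePreserving_rePair ν ν'
  have hK'm : Measurable (fun e : (X × X) × (Y × Y) =>
      min (p e.1.1 / q e.1.1 * (p' e.2.1 / q' e.2.1)) (p e.1.2 / q e.1.2 * (p' e.2.2 / q' e.2.2))) :=
    (((hpm.div hqm).comp (measurable_fst.comp measurable_fst)).mul
      ((hpm'.div hqm').comp (measurable_fst.comp measurable_snd))).min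
      (((hpm.div hqm).comp (measurable_snd.comp measurable_fst)).mul
        ((hpm'.div hqm').comp (measurable_snd.comp measurable_snd)))
  have htrans : ∫ e, min (p e.1.1 / q e.1.1 * (p' e.1.2 / q' e.1.2))
      (p e.2.1 / q e.2.1 * (p' e.2.2 / q' e.2.2)) ∂((ν.prod ν').prod (ν.prod ν'))
      = ∫ e, min (p e.1.1 / q e.1.1 * (p' e.2.1 / q' e.2.1))
          (p e.1.2 / q e.1.2 * (p' e.2.2 / q' e.2.2)) ∂((ν.prod ν).prod (ν'.prod ν')) := by
    rw [← hT.map_eq, integral_map hT.measurable.aemeasurable hK'm.aestronglyMeasurable]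
  rw [htrans]
  -- integrability of the transported kernel: dominated by `w(a)·w′(c)`
  have hdom : Integrable (fun e : (X × X) × (Y × Y) => p e.1.1 / q e.1.1 * (p' e.2.1 / q' e.2.1))
      ((ν.prod ν).prod (ν'.prod ν')) := by
    obtain ⟨hwi, -⟩ := integral_weight_withDensity_eq (μ := μ) hpi hq0 hqm
    exact (hwi.comp_fst ν).mul_prod (hwi'.comp_fst ν')
  have hK'i : Integrable (fun e : (X × X) × (Y × Y) =>
      min (p e.1.1 / q e.1.1 * (p' e.2.1 / q' e.2.1)) (p e.1.2 / q e.1.2 * (p' e.2.2 / q' e.2.2)))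
      ((ν.prod ν).prod (ν'.prod ν')) := by
    refine Integrable.mono' hdom hK'm.aestronglyMeasurable (Filter.Eventually.of_forall fun e => ?_)
    rw [Real.norm_of_nonneg (le_min (mul_nonneg (hw _) (hw' _)) (mul_nonneg (hw _) (hw' _)))]
    exact min_le_left _ _
  rw [integral_prod _ hK'i]
  refine integral_mono hK'i.integral_prod_left hFi fun ab => ?_
  -- inner bound: `∫ min(w a·w′ c, w b·w′ d) d(ν′⊗ν′)(c, d) ≤ min(w a, w b)`
  have hup1 : Integrable (fun cd : Y × Y => p ab.1 / q ab.1 * (p' cd.1 / q' cd.1)) (ν'.prod ν') :=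
    (hwi'.comp_fst ν').const_mul _
  have hup2 : Integrable (fun cd : Y × Y => p ab.2 / q ab.2 * (p' cd.2 / q' cd.2)) (ν'.prod ν') :=
    (hwi'.comp_snd ν').const_mul _
  have e1 : ∫ cd : Y × Y, p ab.1 / q ab.1 * (p' cd.1 / q' cd.1) ∂(ν'.prod ν') = p ab.1 / q ab.1 := by
    have h := integral_fun_fst (μ := ν') (ν := ν') (fun c => p' c / q' c)
    rw [probReal_univ, one_smul] at h
    rw [integral_const_mul, h, hw1', hp1', mul_one]
  have e2 : ∫ cd : Y × Y, p ab.2 / q ab.2 * (p' cd.2 / q' cd.2) ∂(ν'.prod ν') = p ab.2 / q ab.2 := by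
    have h := integral_fun_snd (μ := ν') (ν := ν') (fun d => p' d / q' d)
    rw [probReal_univ, one_smul] at h
    rw [integral_const_mul, h, hw1', hp1', mul_one]
  have hnn : 0 ≤ᵐ[ν'.prod ν'] fun cd : Y × Y =>
      min (p ab.1 / q ab.1 * (p' cd.1 / q' cd.1)) (p ab.2 / q ab.2 * (p' cd.2 / q' cd.2)) :=
    Filter.Eventually.of_forall fun cd =>
      le_min (mul_nonneg (hw _) (hw' _)) (mul_nonneg (hw _) (hw' _))
  refine le_min ?_ ?_
  · rw [← e1]
    exact integral_mono_of_nonneg hnn hup1 (Filter.Eventually.of_forall fun cd => min_le_left _ _)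
  · rw [← e2]
    exact integral_mono_of_nonneg hnn hup2 (Filter.Eventually.of_forall fun cd => min_le_right _ _)

end Summit.Ventures.LatticeQCDFlow.Theory2
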